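import Summits.BirchSwinnertonDyer.Rank1Residual.GaloisImage.CubicKummerIndependenceRat
import Summits.BirchSwinnertonDyer.Rank1Residual.GaloisImage.ThreeTorsionCubeRootDelta
import Summits.BirchSwinnertonDyer.Rank1Residual.GaloisImage.SakamotoN11InstanceLevelOne
import HarnessLib

/-!
# E-b-1 at level one: a `τ ∈ Gal(ℚ̄/ℚ(μ₃))` fixing `∛B`, moving `ζ₉` and `∛Δ`, with
# `E[3]/(τ − 1)E[3] ≃ ℤ/3` — for EVERY elliptic `E/ℚ` whose cube-free discriminant support leaves `B`
# (cell `b2b-bsdres`, team n1011, road E-b / sub-target E-b-1 (crux) at torsion level `3`; seat p13)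

HONEST FRAMING (cell `b2b-bsdres`, run/shared/lean/b2b/bsd-rank1-residual/, verbatim in every
file): the goal of the cell is to DELETE the COMBINATION-SHAPED residual classes of the
Birch–Swinnerton-Dyer formula for ALL analytic-rank `≤ 1` elliptic curves over `ℚ` — "full BSD
formula for every rank `≤ 1` curve in class `C`" assembled STRICTLY from published theorems — so
that the rank-`≤ 1` remainder becomes exactly the CONSTRUCTION-SHAPED classes, which are TYPED
(missing-input `Prop`s), NOT attempted. This is not "finishing BSD". Team n1011 (N10/N11, the
additive block `X4 ∧ p = 3`): research route on the CONSTRUCTION-SHAPED class X4 / §I N11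
(route-1, road E-b); a TOOL theorem about the Galois module `E[3]`, closing NO row by itself;
nothing booked, no mark / label changed; no definition, no named fact, no `sorry`.

## What and why

Road E-b (ROUTE-1 §63.3, "END-b Kurihara route-1 records on anomalous-bad rows") thins the
Kolyvagin primes to `q` with `3 ∤ ord(w mod q)` for the anomalous bad primes `w ∈ B`; by
n1011-p11's `PrimeChoiceCubeResidue` this is read off a Frobenius `σ` FIXING a cube root of each
`w`, FIXING `μ₃` and MOVING `μ₉`, and the thinned prime choice T-PC-THIN
(`PrimeChoiceSakamotoSubgroup[Binders]`) produces such primes from a `τ` in the prescribed coset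
with `E[3]/(τ − 1)E[3] ≃ ℤ/3`.  Its crux E-b-1 (§64.4: "Kummer independence of `B ∪ {3}` over
`ℚ(μ₃)` + a `τ ∈ Γ_{ℚ(μ₃)}` acting as a transvection on `E[3]`, FIXING the chosen cube roots of
`B` and MOVING `ζ₉`"; the commutator-`τ` of `ResidualTauOfSurj` is excluded because it fixes
`ζ₉`) is settled here AT TORSION LEVEL `3`, for every elliptic `E/ℚ` and every finite `B ⊆ ℕ`
under the row certificate `hΔB` ("some prime `ℓ` dividing no `w ∈ B` has `3 ∤ v_ℓ(Δ)`", r1's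
(R-v⁺) / (d3); model-independent since `Δ` changes by twelfth powers):

★★ `exists_tau_fixing_cubeRoots_of_cubeFree_support` — **there is `τ ∈ rootsOfUnityFixer ℚ 3`
with `τ ∉ rootsOfUnityFixer ℚ 9`, `τ t = t` whenever `t³ = w ∈ B`, `τ δ ≠ δ` whenever `δ³ = Δ`,
and `E[3]/(τ − 1)E[3] ≃+ ℤ/3`** (plus the `cokerSubOne` / level-`3^(0+1)` spellings of E1-deep's
binders `hτμ`, `hτq`: `…_cokerSubOne`, `…_levelOne`).  NO surjectivity hypothesis is needed.

Proof.  (1) KUMMER (`CubicKummerIndependenceRat`): some `σ ∈ Gal(ℚ̄/ℚ(μ₃))` fixes `∛B`, moves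
`ζ₉` and moves every cube root of `Δ`.  (2) The cube roots of `Δ` lie in `ℚ(E[3])` (n1011-p02's
`exists_cubeRoots_Δ_mem_divisionField_three`, Serre 1972 §5.3), so with `n = ord ρ̄_{E,3}(σ)`
the element `σ^n` fixes `δ = ∛Δ`, while `σ^n δ = u^n δ` for the primitive cube root of unity
`u = σδ/δ`: hence `3 ∣ n`.  (3) `n ∣ #GL₂(𝔽₃) = 48`, so `9 ∤ n` and `τ := σ^{n/3}` still moves
`ζ₉` and `δ` (`3 ∤ n/3`), fixes `∛B` and `μ₃`, and `ρ̄(τ)` has order exactly `3`.  (4) An element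
of order `3` of `Aut(E[3]) ≅ GL₂(𝔽₃)` is a transvection: `(M − 1)³ = M³ − 1 = 0` in characteristic
`3`, so `det (M − 1) = 0`, the image of `M − 1` is the line through any non-zero column and
`𝔽₃²/(M − 1)𝔽₃² ≃ 𝔽₃` (`torsion_quotient_equiv_zmod_three_of_pow_three_eq_one`, a frame computation
in the style of `ResidualTauOfSurj`).

What is NOT here: no Kolyvagin prime is chosen (that is T-PC-THIN's (t1) instance with
`𝒰 = Gal(ℚ̄/ℚ(μ₉, ∛B)) ∩ ker`, road item E-b-2), no Selmer statement, no record; depth `m + 1 ≥ 2`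
(`E[3^{m+1}]`, `μ_{3^{m+2}}`, `3^{m+1}`-th roots of `B`) needs the `3`-adic tower and
`SL₂(ℤ/3^k)^{ab}` and is not attempted.

References: J.-P. Serre, Invent. Math. 15 (1972) §5.3 [Serre1972]; standard Kummer theory (Lang,
*Algebra* VI §8); K. Rubin, *Euler Systems* (2000) §2.1 `Hyp(ℚ, T)` (a); R. Sakamoto, JTNB 36
(2024) §2 (H.2) [Sakamoto2024]; cells/n1011/ROUTE-1.md §61.3, §63.3, §64.4; p13 GEN 15
`ENDB-ROAD-NOTE.md` item 3; p02 GEN 19 `E-b-1-RV-NOTE.md` (G1)–(G3).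
-/

noncomputable section

open scoped Classical
open Field Matrix
open WeierstrassCurve Literature.NumberTheory.EllipticCurves Literature.NumberTheory.GaloisRepresentations
  Literature.NumberTheory.GaloisCohomology

namespace Summit.BirchSwinnertonDyer.Rank1Residual.GaloisImage

variable (W : WeierstrassCurve ℚ) [W.IsElliptic]

/-! ### An element of order `3` of `Aut(E[3])` is a transvection -/

/-- The `2 × 2` cross product `D(a, b) = a₀ b₁ − a₁ b₀` is multiplicative under a matrix:
`D(N a, N b) = det N · D(a, b)`. [folklore] -/
theorem cross_mulVec_mulVec {R : Type*} [CommRing R] (N : Matrix (Fin 2) (Fin 2) R)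
    (a b : Fin 2 → R) :
    (N *ᵥ a) 0 * (N *ᵥ b) 1 - (N *ᵥ a) 1 * (N *ᵥ b) 0 = N.det * (a 0 * b 1 - a 1 * b 0) := by
  simp only [Matrix.mulVec, dotProduct, Fin.sum_univ_two, Matrix.det_fin_two]
  ring

/-- Two parallel vectors in `K²`: if `s ≠ 0` and `s₀ w₁ = s₁ w₀` then `w = c • s`. [folklore] -/
theorem exists_eq_smul_of_cross_eq_zero {K : Type*} [Field K] {s w : Fin 2 → K} (hs : s ≠ 0)
    (h : s 0 * w 1 - s 1 * w 0 = 0) : ∃ c : K, w = c • s := by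
  by_cases h0 : s 0 = 0
  · have h1 : s 1 ≠ 0 := fun h1 => hs (by funext i; fin_cases i <;> assumption)
    refine ⟨w 1 / s 1, funext fun i => ?_⟩
    fin_cases i
    · rw [h0, zero_mul, zero_sub, neg_eq_zero, mul_eq_zero] at h
      simp [h0, h.resolve_left h1]
    · simp [div_mul_cancel₀ _ h1]
  · refine ⟨w 0 / s 0, funext fun i => ?_⟩
    fin_cases i
    · simp [div_mul_cancel₀ _ h0]
    · have : w 1 = w 0 / s 0 * s 1 := by
        field_simp
        linear_combination h
      simpa using this

/-- **An automorphism of `E[3]` of order `3` is a transvection: `E[3]/(h − 1)E[3] ≃+ ℤ/3`.**  For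
`E/ℚ` elliptic and `h ∈ Aut(E[3])` with `h³ = 1`, `h ≠ 1`: in a frame `E[3] ≃ 𝔽₃²`
(`exists_frame_galoisRepTorsion_rat`) `h` is a matrix `M` with `(M − 1)³ = M³ − 1 = 0`
(characteristic `3`), so `det (M − 1) = 0`, the columns of `N = M − 1 ≠ 0` are parallel to a
non-zero `s = N v`, the image of `N` is the line `𝔽₃ s`, and the cross product with `s` is a
surjection `𝔽₃² ↠ 𝔽₃` with kernel that line. [folklore] -/
theorem torsion_quotient_equiv_zmod_three_of_pow_three_eq_one
    (h : Multiplicative (AddAut (geomTorsion W 3))) (h3 : h ^ 3 = 1) (h1 : h ≠ 1) :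
    Nonempty ((geomTorsion W 3 ⧸
      ((Multiplicative.toAdd h).toAddMonoidHom - AddMonoidHom.id (geomTorsion W 3)).range) ≃+
        ZMod 3) := by
  haveI : Fact (Nat.Prime 3) := ⟨Nat.prime_three⟩
  obtain ⟨e, Φ, he, -, -, -, -⟩ := exists_frame_galoisRepTorsion_rat W 3
  set M : Matrix (Fin 2) (Fin 2) (ZMod 3) :=
    ((Φ h : GL (Fin 2) (ZMod 3)) : Matrix (Fin 2) (Fin 2) (ZMod 3)) with hM
  set N : Matrix (Fin 2) (Fin 2) (ZMod 3) := M - 1 with hN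
  set f : geomTorsion W 3 →+ geomTorsion W 3 :=
    (Multiplicative.toAdd h).toAddMonoidHom - AddMonoidHom.id (geomTorsion W 3) with hf
  -- `e ∘ f = N ∘ e`
  have hef : ∀ x : geomTorsion W 3, e (f x) = N *ᵥ e x := fun x => by
    rw [hf, AddMonoidHom.sub_apply, AddMonoidHom.id_apply, AddEquiv.coe_toAddMonoidHom, map_sub,
      he h x, hN, Matrix.sub_mulVec, Matrix.one_mulVec]
  -- `M³ = 1`, `M ≠ 1`
  have hM3 : M ^ 3 = 1 := by
    rw [hM, ← Units.val_pow_eq_pow_val, ← map_pow, h3, map_one, Units.val_one]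
  have hM1 : M ≠ 1 := fun hM1 => h1 (Φ.injective (by
    rw [map_one]; exact Units.ext (by rw [← hM, hM1, Units.val_one])))
  -- `N³ = 0` (characteristic `3`), hence `det N = 0`
  have hN3 : N ^ 3 = 0 := by
    have hid : N ^ 3 = M ^ 3 - 1 - 3 • (M ^ 2 - M) := by rw [hN]; noncomm_ring
    have h0 : (3 • (M ^ 2 - M) : Matrix (Fin 2) (Fin 2) (ZMod 3)) = 0 := by
      ext i j
      rw [Matrix.smul_apply, nsmul_eq_mul, show ((3 : ℕ) : ZMod 3) = 0 from rfl, zero_mul,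
        Matrix.zero_apply]
    rw [hid, hM3, sub_self, h0, sub_zero]
  have hdet : N.det = 0 := by
    have := congr_arg Matrix.det hN3
    rw [Matrix.det_pow, Matrix.det_zero] at this
    exact pow_eq_zero_iff (n := 3) (by norm_num) |>.mp this
    -- (`Matrix.det_zero` needs `Nonempty (Fin 2)`, automatic)
  -- a vector moved by `N`
  have hN0 : N ≠ 0 := fun hN0 => hM1 (sub_eq_zero.mp (hN ▸ hN0))
  obtain ⟨v, hv⟩ : ∃ v : Fin 2 → ZMod 3, N *ᵥ v ≠ 0 := by
    by_contra hall
    push Not at hall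
    exact hN0 (Matrix.ext fun i j => by
      have := congr_fun (hall (Pi.single j 1)) i
      rw [Matrix.mulVec_single_one, Matrix.col_apply, Pi.zero_apply] at this
      rwa [Matrix.zero_apply])
  set s : Fin 2 → ZMod 3 := N *ᵥ v with hs
  -- the cross product with `s`, pulled back along `e`
  set lam0 : (Fin 2 → ZMod 3) →+ ZMod 3 :=
    { toFun := fun w => s 0 * w 1 - s 1 * w 0
      map_zero' := by simp
      map_add' := fun a b => by simp only [Pi.add_apply]; ring } with hlam0
  have hlam0_apply : ∀ w, lam0 w = s 0 * w 1 - s 1 * w 0 := fun w => rfl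
  set lam : geomTorsion W 3 →+ ZMod 3 := lam0.comp e.toAddMonoidHom with hlam
  have hlam_apply : ∀ x, lam x = s 0 * e x 1 - s 1 * e x 0 := fun x => rfl
  -- `lam` is onto
  have hsurj : Function.Surjective lam := by
    intro y
    by_cases h0 : s 0 = 0
    · have h1 : s 1 ≠ 0 := fun h1 => hv (by funext i; fin_cases i <;> assumption)
      refine ⟨e.symm (Pi.single 0 (-(y / s 1))), ?_⟩
      rw [hlam_apply, AddEquiv.apply_symm_apply]
      simp [h0, mul_div_cancel₀ _ h1]
    · refine ⟨e.symm (Pi.single 1 (y / s 0)), ?_⟩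
      rw [hlam_apply, AddEquiv.apply_symm_apply]
      simp [mul_div_cancel₀ _ h0]
  -- `ker lam = range f`
  have hker : f.range = lam.ker := by
    apply le_antisymm
    · rintro _ ⟨x, rfl⟩
      rw [AddMonoidHom.mem_ker, hlam_apply, hef]
      have := cross_mulVec_mulVec N v (e x)
      rw [hdet, zero_mul, ← hs] at this
      exact this
    · intro x hx
      rw [AddMonoidHom.mem_ker, hlam_apply] at hx
      obtain ⟨c, hc⟩ := exists_eq_smul_of_cross_eq_zero hv hx
      refine ⟨e.symm (c • v), e.injective ?_⟩
      rw [hef, AddEquiv.apply_symm_apply, Matrix.mulVec_smul, ← hs, ← hc]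
  exact ⟨(QuotientAddGroup.quotientAddEquivOfEq hker).trans
    (QuotientAddGroup.quotientKerEquivOfSurjective lam hsurj)⟩

/-! ### The E-b-1 `τ` -/

/-- ★★ **E-b-1 at torsion level `3`.**  Let `E = W/ℚ` be elliptic and `B` a finite set of
naturals such that some prime `ℓ` divides no `w ∈ B` and `3 ∤ v_ℓ(Δ)` (the cube-free support of
`Δ` is not inside `B` — road E-b's row certificate `hΔB`).  Then there is `τ ∈ Γ_ℚ` with
* `τ ∈ Gal(ℚ̄/ℚ(μ₃))` and `τ ∉ Gal(ℚ̄/ℚ(μ₉))` (`τ` fixes `μ₃`, moves `ζ₉`),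
* `τ t = t` for every `t ∈ ℚ̄` with `t³ = w`, `w ∈ B` (fixes all cube roots of `B`),
* `τ δ ≠ δ` for every `δ ∈ ℚ̄` with `δ³ = Δ`,
* `E[3]/(τ − 1)E[3] ≃+ ℤ/3` (`τ` is a transvection on `E[3]`).
NO surjectivity hypothesis.  Proof: the Kummer `σ` of
`CubicKummer.exists_mem_fixer_cubeRoots_not_mem_nine_smul_ne_cubeRoot`; `∛Δ ∈ ℚ(E[3])` forces
`3 ∣ ord ρ̄(σ) ∣ 48`; `τ = σ^{ord ρ̄(σ)/3}`; order-`3` automorphisms of `E[3]` are transvections.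
[cite: Serre1972, §5.3] [cite: Sakamoto2024, §2 hypothesis (H.2) (p. 921)] -/
theorem exists_tau_fixing_cubeRoots_of_cubeFree_support (B : Finset ℕ)
    (hΔB : ∃ ℓ : ℕ, ℓ.Prime ∧ (∀ w ∈ B, ¬ ℓ ∣ w) ∧ ¬ (3 : ℤ) ∣ padicValRat ℓ W.Δ) :
    ∃ τ : absoluteGaloisGroup ℚ, τ ∈ rootsOfUnityFixer ℚ 3 ∧ τ ∉ rootsOfUnityFixer ℚ 9 ∧
      (∀ w ∈ B, ∀ t : AlgebraicClosure ℚ, t ^ 3 = (w : AlgebraicClosure ℚ) → τ • t = t) ∧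
      (∀ δ : AlgebraicClosure ℚ, δ ^ 3 = algebraMap ℚ (AlgebraicClosure ℚ) W.Δ → τ • δ ≠ δ) ∧
      Nonempty ((geomTorsion W 3 ⧸
        ((Multiplicative.toAdd (galoisRepTorsion W 3 τ)).toAddMonoidHom -
          AddMonoidHom.id (geomTorsion W 3)).range) ≃+ ZMod 3) := by
  haveI : Fact (Nat.Prime 3) := ⟨Nat.prime_three⟩
  have hinj : Function.Injective (algebraMap ℚ (AlgebraicClosure ℚ)) :=
    (algebraMap ℚ (AlgebraicClosure ℚ)).injective
  have hΔ0 : algebraMap ℚ (AlgebraicClosure ℚ) W.Δ ≠ 0 := by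
    rw [Ne, map_eq_zero_iff _ hinj]; exact W.isUnit_Δ.ne_zero
  -- (1) the Kummer `σ`
  obtain ⟨σ, hσ3, hσ9, hfix, hmove⟩ :=
    CubicKummer.exists_mem_fixer_cubeRoots_not_mem_nine_smul_ne_cubeRoot B hΔB
  -- (2) a cube root `δ` of `Δ` inside `ℚ(E[3])`, moved by `σ` through the character `u`
  --     (the two `ℚ`-algebra structures on `ℚ̄` have the same `algebraMap`: `ℚ →+* ℚ̄` is unique)
  have hamap : ∀ f g : ℚ →+* AlgebraicClosure ℚ, f W.Δ = g W.Δ := fun f g => by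
    rw [Subsingleton.elim f g]
  obtain ⟨-, δ, -, hδ₀, hδK, -, -⟩ := exists_cubeRoots_Δ_mem_divisionField_three (W := W)
  have hδ : δ ^ 3 = algebraMap ℚ (AlgebraicClosure ℚ) W.Δ := hδ₀.trans (hamap _ _)
  have hδ0 : δ ≠ 0 := by rintro rfl; exact hΔ0 (by rw [← hδ]; norm_num)
  obtain ⟨u, hu, hσu⟩ := CubicKummer.exists_smul_eq_mul_of_pow_three_eq σ (smul_algebraMap σ W.Δ) hδ
  have hu1 : u ≠ 1 := fun hu1 => hmove δ hδ (by rw [hσu, hu1, one_mul])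
  have hordu : orderOf u = 3 := orderOf_eq_prime hu hu1
  have hσu' : σ • u = u := mem_rootsOfUnityFixer_iff.mp hσ3 u hu
  -- the order `n` of `ρ̄(σ)` divides `48`
  set ρ := galoisRepTorsion W 3 with hρ
  set n : ℕ := orderOf (ρ σ) with hn
  obtain ⟨e, Φ, he, -, -, -, -⟩ := exists_frame_galoisRepTorsion_rat W 3
  have hn48 : n ∣ 48 := by
    have h1 : orderOf (Φ (ρ σ)) = n := orderOf_injective Φ.toMonoidHom Φ.injective (ρ σ)
    have h2 := orderOf_dvd_natCard (Φ (ρ σ))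
    rw [h1, Matrix.card_GL_field, Fin.prod_univ_two, ZMod.card] at h2
    simpa using h2
  have hn0 : n ≠ 0 := by
    have h1 : orderOf (Φ (ρ σ)) = n := orderOf_injective Φ.toMonoidHom Φ.injective (ρ σ)
    rw [← h1]; exact (orderOf_pos _).ne'
  -- `3 ∣ n`: `σ^n` fixes `δ ∈ ℚ(E[3])` but acts on it by `u^n`
  have hn3 : 3 ∣ n := by
    have hρn : ρ (σ ^ n) = 1 := by rw [map_pow, hn, pow_orderOf_eq_one]
    have hσn : ∀ T : geomTorsion W 3, σ ^ n • T = T := fun T => by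
      rw [← galoisRepTorsion_apply, ← hρ, hρn]
      rfl
    have h1 : σ ^ n • δ = δ := (W.mem_divisionField_iff 3).mp hδK (σ ^ n) hσn
    rw [CubicKummer.pow_smul_eq_pow_mul hσu' hσu n, mul_left_eq_self₀] at h1
    rw [← hordu]
    exact orderOf_dvd_of_pow_eq_one (h1.resolve_right hδ0)
  -- `τ = σ^m`, `n = 3m`, `3 ∤ m`
  set m : ℕ := n / 3 with hm
  have hnm : n = 3 * m := (Nat.mul_div_cancel' hn3).symm
  have hm0 : m ≠ 0 := fun h0 => hn0 (by rw [hnm, h0, mul_zero])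
  have hm3 : ¬ 3 ∣ m := fun h => by
    have h9 : 9 ∣ 48 := (show (9 : ℕ) = 3 * 3 from rfl) ▸
      (hnm ▸ Nat.mul_dvd_mul_left 3 h : 3 * 3 ∣ n).trans hn48
    exact absurd h9 (by norm_num)
  have hum : ∀ {u' : AlgebraicClosure ℚ}, u' ^ 3 = 1 → u' ≠ 1 → u' ^ m ≠ 1 := fun hu' hu'1 h =>
    hm3 (orderOf_eq_prime hu' hu'1 ▸ orderOf_dvd_of_pow_eq_one h)
  refine ⟨σ ^ m, Subgroup.pow_mem _ hσ3 m, fun h9 => ?_, fun w hw t ht =>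
    CubicKummer.pow_smul_eq_self (hfix w hw t ht) m, fun δ' hδ' => ?_, ?_⟩
  · -- `σ^m` moves `ζ₉`
    obtain ⟨z, hz9, hσz⟩ : ∃ z : AlgebraicClosure ℚ, z ^ 9 = 1 ∧ σ • z ≠ z := by
      by_contra hall
      push Not at hall
      exact hσ9 (mem_rootsOfUnityFixer_iff.mpr hall)
    have hz3 : σ • z ^ 3 = z ^ 3 := mem_rootsOfUnityFixer_iff.mp hσ3 (z ^ 3)
      (by rw [← pow_mul]; exact hz9)
    obtain ⟨u', hu', hσu'z⟩ := CubicKummer.exists_smul_eq_mul_of_pow_three_eq σ hz3 rfl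
    have hu'1 : u' ≠ 1 := fun h => hσz (by rw [hσu'z, h, one_mul])
    have hz0 : z ≠ 0 := by rintro rfl; exact hσz (smul_zero σ)
    have h1 := mem_rootsOfUnityFixer_iff.mp h9 z hz9
    rw [CubicKummer.pow_smul_eq_pow_mul (mem_rootsOfUnityFixer_iff.mp hσ3 u' hu') hσu'z m,
      mul_left_eq_self₀] at h1
    exact (hum hu' hu'1) (h1.resolve_right hz0)
  · -- `σ^m` moves every cube root of `Δ`
    refine CubicKummer.smul_ne_self_of_pow_three_eq (Subgroup.pow_mem _ hσ3 m) hΔ0 hδ ?_ hδ'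
    rw [CubicKummer.pow_smul_eq_pow_mul hσu' hσu m, Ne, mul_left_eq_self₀, not_or]
    exact ⟨hum hu hu1, hδ0⟩
  · -- `ρ̄(σ^m)` has order `3`, hence is a transvection
    have hord : orderOf (ρ (σ ^ m)) = 3 := by
      rw [map_pow, orderOf_pow' _ hm0, ← hn, hnm, Nat.gcd_mul_left_left, Nat.mul_div_cancel _ 
        (Nat.pos_of_ne_zero hm0)]
    refine torsion_quotient_equiv_zmod_three_of_pow_three_eq_one W (ρ (σ ^ m)) ?_ ?_
    · rw [← hord]; exact pow_orderOf_eq_one _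
    · intro h1
      rw [h1, orderOf_one] at hord
      exact absurd hord (by norm_num)

/-- ★★ **E-b-1 at torsion level `3`, `cokerSubOne` spelling** (the binder `hτ` of T-PC-THIN
`PrimeChoiceSakamotoSubgroup[Binders]`, `ρ = W.torsionGaloisModule 3`): same `τ`, with
`Nonempty (cokerSubOne (W.torsionGaloisModule 3) τ ≃+ ZMod 3)`.
[cite: Sakamoto2024, §2 hypothesis (H.2) (p. 921)] -/
theorem exists_tau_fixing_cubeRoots_of_cubeFree_support_cokerSubOne (B : Finset ℕ)
    (hΔB : ∃ ℓ : ℕ, ℓ.Prime ∧ (∀ w ∈ B, ¬ ℓ ∣ w) ∧ ¬ (3 : ℤ) ∣ padicValRat ℓ W.Δ) :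
    ∃ τ : absoluteGaloisGroup ℚ, τ ∈ rootsOfUnityFixer ℚ 3 ∧ τ ∉ rootsOfUnityFixer ℚ 9 ∧
      (∀ w ∈ B, ∀ t : AlgebraicClosure ℚ, t ^ 3 = (w : AlgebraicClosure ℚ) → τ • t = t) ∧
      (∀ δ : AlgebraicClosure ℚ, δ ^ 3 = algebraMap ℚ (AlgebraicClosure ℚ) W.Δ → τ • δ ≠ δ) ∧
      Nonempty (cokerSubOne (W.torsionGaloisModule ((3 : ℕ) : ℤ)) τ ≃+ ZMod 3) := by
  obtain ⟨τ, h3, h9, hfix, hmove, hq⟩ := exists_tau_fixing_cubeRoots_of_cubeFree_support W B hΔB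
  refine ⟨τ, h3, h9, hfix, hmove, ?_⟩
  have hf : ((W.torsionGaloisModule ((3 : ℕ) : ℤ)) τ).toAddMonoidHom =
      (Multiplicative.toAdd (galoisRepTorsion W ((3 : ℕ) : ℤ) τ)).toAddMonoidHom :=
    AddMonoidHom.ext fun x => by
      rw [LinearMap.toAddMonoidHom_coe, torsionGaloisModule_apply_apply]; rfl
  change Nonempty (geomTorsion W _ ⧸ (((W.torsionGaloisModule _) τ).toAddMonoidHom -
    AddMonoidHom.id _).range ≃+ _)
  rw [hf]
  exact hq

/-- ★★ **E-b-1 at torsion level `3`, level-`3^(0+1)` spelling** — literally the binders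
`hτμ : τ ∈ rootsOfUnityFixer ℚ (3 ^ (0 + 1))`,
`hτq : Nonempty (cokerSubOne (W.torsionGaloisModule (3 ^ 0 * 3)) τ ≃+ ZMod (3 ^ (0 + 1)))` of the
level-one Kolyvagin-system assembly (`SakamotoN11InstanceLevelOne`, E1-deep
`KolyvaginPrimeOfFrobeniusClassDeep`), together with `τ ∉ rootsOfUnityFixer ℚ (3 ^ (0 + 2))` and
the cube-root clauses (`PrimeChoiceCubeResidue.not_three_dvd_orderOf_of_smul_eq_depth`, `m = 0`).
[cite: Sakamoto2024, §2 hypothesis (H.2) (p. 921)] -/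
theorem exists_tau_fixing_cubeRoots_of_cubeFree_support_levelOne (B : Finset ℕ)
    (hΔB : ∃ ℓ : ℕ, ℓ.Prime ∧ (∀ w ∈ B, ¬ ℓ ∣ w) ∧ ¬ (3 : ℤ) ∣ padicValRat ℓ W.Δ) :
    ∃ τ : absoluteGaloisGroup ℚ, τ ∈ rootsOfUnityFixer ℚ (3 ^ (0 + 1)) ∧
      τ ∉ rootsOfUnityFixer ℚ (3 ^ (0 + 2)) ∧
      (∀ w ∈ B, ∀ t : AlgebraicClosure ℚ,
        t ^ (3 ^ (0 + 1)) = (w : AlgebraicClosure ℚ) → τ • t = t) ∧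
      (∀ δ : AlgebraicClosure ℚ, δ ^ 3 = algebraMap ℚ (AlgebraicClosure ℚ) W.Δ → τ • δ ≠ δ) ∧
      Nonempty (cokerSubOne (W.torsionGaloisModule (((3 : ℕ) : ℤ) ^ 0 * ((3 : ℕ) : ℤ))) τ ≃+
        ZMod (3 ^ (0 + 1))) := by
  obtain ⟨τ, h3, h9, hfix, hmove, hq⟩ :=
    exists_tau_fixing_cubeRoots_of_cubeFree_support_cokerSubOne W B hΔB
  refine ⟨τ, by simpa using h3, by simpa using h9, fun w hw t ht => hfix w hw t (by simpa using ht),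
    hmove, ?_⟩
  have hlevel : ((3 : ℕ) : ℤ) ^ 0 * ((3 : ℕ) : ℤ) = ((3 : ℕ) : ℤ) := by rw [pow_zero, one_mul]
  rw [hlevel]
  simpa using hq

end Summit.BirchSwinnertonDyer.Rank1Residual.GaloisImage

end
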